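import Literature.Combinatorics.SimpleGraph.TriangleFreeLocalCutTheorem4
import Mathlib.Analysis.Real.Pi.Wallis
import Mathlib.Analysis.SpecialFunctions.Exponential
import HarnessLib

/-!
# HRSS Theorem 4 for every degree `d ≥ 2`: the Appendix-A estimates for `d > 3000`

Source. J. Hirvonen, J. Rybicki, S. Schmid, J. Suomela, *Large cuts with local algorithms on
triangle-free graphs*, Electron. J. Combin. 24(4) (2017) P4.21 = arXiv:1402.2543
[HirvonenRybickiSchmidSuomela2017], §2.6 Theorem 4 (“Let `d ≥ 2` and `τ = ⌈(d + √d)/2⌉`. Then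
`α(τ, d) ≥ ½ + 9/(32√d)`.”) and Appendix A = §4 of the arXiv version (held text p0008–p0009):
“Verify cases `d = 2, 3, …, 3000` with a computer. Prove a closed-form lower bound for `d > 3000`”,
Fact 5, Lemma 6, Lemma 7, “Odd d”, “Even d”.

The computer range `2 ≤ d ≤ 3000` is replayed in the kernel in
`TriangleFreeLocalCutTheorem4` (`hrss_theorem4_le_3000`). THIS FILE formalises the second,
analytic part, following the printed proof step by step, and concludes Theorem 4 for ALL `d ≥ 2`
(0 facts, 0 sorry):

* `cbin n = 4^{-n} C(2n,n)`; `choose_sq_mul_wallis` (`C(2n,n)²(2n+1)·W_n = 16^n` with Mathlib's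
  Wallis partial product), `cbin_sq_ge` / `cbin_sq_le` (from `Real.Wallis.W_le` / `le_W`),
  **`hrss_fact5`** = Fact 5 as printed (`0.999/√(πn) < cbin n < 1/√(πn)`, `n ≥ 1500`; proved for
  `n ≥ 250` resp. `n ≥ 1`), and the sharper working form `sqrt_le_cbin : √(2/(π(2n+1))) ≤ cbin n`.
* `choose_succ_le_of_le`, `choose_anti` (rows are non-increasing past the middle),
  `choose_middle_add_ge` (`C(2n,n+δ) ≥ (1−δ/n)^δ C(2n,n)`, the product estimate of Lemma 6),
  `one_sub_div_pow_le_succ` / `one_sub_div_pow_mono` (`(1 − c/δ)^δ` is non-decreasing — Bernoulli),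
  `dlt j n = δ_j(n) = ⌊j√(n/32)⌋` with its bracketing lemmas, `g j = e^{−j²/32}`,
  **`hrss_lemma6`** = Lemma 6 (`C(2n, n+δ_j(n)) ≥ 0.995·g_j·C(2n,n)`, `j ∈ {1,2,3,4}`, `n ≥ 1500`;
  the four numerical facts `h_j(δ_j(1500)) > 0.995 g_j` are checked against truncated exponential
  series, `exp_neg_le_inv_sum`).
* `sum_upper_blocks_ge` (the four-block lower Riemann sum with Abel summation), `g_sum_ge` /
  `g_one_le` / `g_four_ge` (decimal bounds on the `g_j` via `Real.exp_bound`),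
  **`hrss_lemma7_half`** (`Σ_{i=1}^{δ_4(n)} C(2n,n+i) ≥ 0.3045·4^n`; the paper's `0.3044`),
  `sum_Ioc_reflect`, `sum_Ioc_le_sum_Ico`, and **`hrss_lemma7_first` / `hrss_lemma7_second`** =
  Lemma 7 as printed (`> 0.6088·4^n` and `> 0.5975·4^n`).
* `threshold_odd` / `threshold_even` (`δ'+1 ≤ τ−n ≤ δ'+2`, resp. `δ' ≤ τ−n ≤ δ'+1`, for the tree's
  `hrssThreshold d = ⌈(d+√d)/2⌉`), `two_mul_sum_choose_odd_row` (the identity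
  `Σ_{|i|≤k} C(2n,n+i) = 2 Σ_{|i|≤k} C(2n−1,n+i)`), **`hrss_theorem4_odd`**, **`hrss_theorem4_even`**,
  **`hrss_theorem4_large`** (`d > 3000`), **`hrss_theorem4`** (every `d ≥ 2`) and the corollary
  **`exists_cut_ge_hrss_all`**: every `d`-regular triangle-free graph, `d ≥ 2`, has a cut with at
  least `(½ + 0.28125/√d)·|E|` edges.

Deviations from the printed constants (the theorem proved is exactly the printed Theorem 4): the
paper rounds at every step (`0.999`, `0.995`, `0.5680`, `0.9693`, `0.3185`, `0.3044`, `0.964`,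
`0.982`, `0.2823`, `0.2822`); we keep Wallis' `√(2/(π(2n+1)))` in place of `0.999/√(πn)` and use
`0.963`, `0.9815` for the two ratio factors (the printed `0.964`, `0.982` hold only through the
integrality of `δ'` near `n = 1500`; the relaxation `δ' ≤ √(n/2)` gives `0.9635…`, `0.9817…`),
which the final comparison absorbs (`81π ≤ 2048·K²` with `K ≥ 0.3537`). Lemma 6 and Lemma 7 are
proved with the printed constants `0.995`, `0.6088`, `0.5975`.

HONEST FRAMING: instance-level adjudication of specific advantage claims; no claim about BQP vs
BPP or the summit. (Context: the classical side of Hastings' QAOA₁-versus-local-algorithm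
comparison on triangle-free regular graphs, `QAOAVersusThreshold`.)
-/

noncomputable section

namespace Literature.Combinatorics.SimpleGraph.TriangleFreeLocalCutLargeDegree

open Finset Real
open Literature.Combinatorics.SimpleGraph.TriangleFreeLocalCut
open Literature.Combinatorics.SimpleGraph.TriangleFreeLocalCutTheorem4

/-! ## Fact 5 — the central binomial coefficient against `1/√(πn)` (via Wallis' product) -/

/-- `4^{-n} · C(2n, n)`, the normalised central binomial coefficient. [cite:
HirvonenRybickiSchmidSuomela2017, Appendix A, Fact 5] -/
def cbin (n : ℕ) : ℝ := ((2 * n).choose n : ℝ) / 4 ^ n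

/-- Positivity of `cbin`. [folklore] -/
private theorem cbin_pos (n : ℕ) : 0 < cbin n := by
  unfold cbin
  have : 0 < (2 * n).choose n := Nat.choose_pos (by omega)
  positivity

/-- `C(2n,n)² · (2n+1) · W_n = 16^n`, where `W_n` is Mathlib's Wallis partial product
`∏_{i<n} (2i+2)/(2i+1) · (2i+2)/(2i+3)`. [folklore] -/
private theorem choose_sq_mul_wallis (n : ℕ) :
    ((2 * n).choose n : ℝ) ^ 2 * (2 * n + 1) * Real.Wallis.W n = 16 ^ n := by
  rw [Real.Wallis.W_eq_factorial_ratio]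
  have h : ((2 * n).choose n : ℝ) * (n.factorial : ℝ) * (n.factorial : ℝ) =
      ((2 * n).factorial : ℝ) := by
    have h0 := Nat.choose_mul_factorial_mul_factorial (show n ≤ 2 * n by omega)
    rw [show 2 * n - n = n by omega] at h0
    exact_mod_cast h0
  have hf : (0 : ℝ) < ((2 * n).factorial : ℝ) := by positivity
  have h16 : (16 : ℝ) ^ n = 2 ^ (4 * n) := by
    rw [pow_mul]; norm_num
  rw [h16, mul_div_assoc', div_eq_iff (by positivity), ← h]
  ring

/-- `cbin n ^ 2 = C(2n,n)²/16^n`. [folklore] -/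
private theorem cbin_sq (n : ℕ) : cbin n ^ 2 = ((2 * n).choose n : ℝ) ^ 2 / 16 ^ n := by
  unfold cbin
  rw [div_pow, ← pow_mul, mul_comm n 2, pow_mul]
  norm_num

/-- Lower Wallis bound: `cbin n ² ≥ 2/(π(2n+1))` (from `W_n ≤ π/2`). [folklore] -/
private theorem cbin_sq_ge (n : ℕ) : 2 / (π * (2 * n + 1)) ≤ cbin n ^ 2 := by
  have hW := Real.Wallis.W_le n
  have hWpos := Real.Wallis.W_pos n
  have key := choose_sq_mul_wallis n
  rw [cbin_sq, div_le_div_iff₀ (by positivity) (by positivity)]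
  have h0 : (0 : ℝ) ≤ ((2 * n).choose n : ℝ) ^ 2 * (2 * n + 1) := by positivity
  nlinarith [mul_le_mul_of_nonneg_left hW h0]

/-- Upper Wallis bound: `cbin n ² ≤ 4(n+1)/(π(2n+1)²)` (from `W_n ≥ (2n+1)/(2n+2) · π/2`).
[folklore] -/
private theorem cbin_sq_le (n : ℕ) : cbin n ^ 2 ≤ 4 * (n + 1) / (π * (2 * n + 1) ^ 2) := by
  have hW := Real.Wallis.le_W n
  have key := choose_sq_mul_wallis n
  rw [cbin_sq, div_le_div_iff₀ (by positivity) (by positivity)]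
  have h0 : (0 : ℝ) ≤ ((2 * n).choose n : ℝ) ^ 2 * (2 * n + 1) := by positivity
  have h1 := mul_le_mul_of_nonneg_left hW h0
  have h2 : ((2 : ℝ) * n + 1) / (2 * n + 2) * (π / 2) * (2 * n + 2) = (2 * n + 1) * π / 2 := by
    field_simp
  nlinarith [h1, Real.pi_pos]

/-- `cbin n ≥ √(2/(π(2n+1)))`, the form of Fact 5's lower bound used below. [cite:
HirvonenRybickiSchmidSuomela2017, Appendix A, Fact 5] -/
theorem sqrt_le_cbin (n : ℕ) : Real.sqrt (2 / (π * (2 * n + 1))) ≤ cbin n := by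
  rw [← Real.sqrt_sq (cbin_pos n).le]
  exact Real.sqrt_le_sqrt (cbin_sq_ge n)

/-- **Fact 5 (HRSS), lower half: `0.999/√(πn) < 4^{-n} C(2n,n)`** — printed for `n ≥ 1500`; it
already holds for `n ≥ 250` (proved from Wallis' `W_n ≤ π/2`). [cite:
HirvonenRybickiSchmidSuomela2017, Appendix A, Fact 5] -/
theorem hrss_fact5_lower {n : ℕ} (hn : 250 ≤ n) : 0.999 / Real.sqrt (π * n) < cbin n := by
  have hn' : (250 : ℝ) ≤ n := by exact_mod_cast hn
  have hπ := Real.pi_pos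
  refine lt_of_pow_lt_pow_left₀ 2 (cbin_pos n).le ?_
  refine lt_of_lt_of_le ?_ (cbin_sq_ge n)
  rw [div_pow, Real.sq_sqrt (by positivity), div_lt_div_iff₀ (by positivity) (by positivity)]
  nlinarith

/-- **Fact 5 (HRSS), upper half: `4^{-n} C(2n,n) < 1/√(πn)`** — printed for `n ≥ 1500`; it holds
for every `n ≥ 1` (from Wallis' `W_n ≥ (2n+1)/(2n+2)·π/2`). [cite: HirvonenRybickiSchmidSuomela2017,
Appendix A, Fact 5] -/
theorem hrss_fact5_upper {n : ℕ} (hn : 1 ≤ n) : cbin n < 1 / Real.sqrt (π * n) := by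
  have hn' : (1 : ℝ) ≤ n := by exact_mod_cast hn
  have hπ := Real.pi_pos
  refine lt_of_pow_lt_pow_left₀ 2 (by positivity) ?_
  refine lt_of_le_of_lt (cbin_sq_le n) ?_
  rw [div_pow, Real.sq_sqrt (by positivity), one_pow,
    div_lt_div_iff₀ (by positivity) (by positivity)]
  nlinarith

/-- **Fact 5 (HRSS) as printed**: for `n ≥ 1500`, `0.999/√(πn) < 4^{-n} C(2n,n) < 1/√(πn)`. [cite:
HirvonenRybickiSchmidSuomela2017, Appendix A, Fact 5] -/
theorem hrss_fact5 {n : ℕ} (hn : 1500 ≤ n) :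
    0.999 / Real.sqrt (π * n) < cbin n ∧ cbin n < 1 / Real.sqrt (π * n) :=
  ⟨hrss_fact5_lower (by omega), hrss_fact5_upper (by omega)⟩

/-! ## Binomial coefficients away from the middle -/

/-- Past the middle a row of Pascal's triangle is non-increasing: `C(m, i+1) ≤ C(m, i)` when
`m ≤ 2i+1`. [folklore] -/
private theorem choose_succ_le_of_le {m i : ℕ} (h : m ≤ 2 * i + 1) : m.choose (i + 1) ≤ m.choose i := by
  have h1 := Nat.choose_succ_right_eq m i
  have h2 : m.choose (i + 1) * (i + 1) ≤ m.choose i * (i + 1) := by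
    rw [h1]; exact Nat.mul_le_mul_left _ (by omega)
  exact Nat.le_of_mul_le_mul_right h2 (by omega)

/-- Iterated: `C(m, b) ≤ C(m, a)` for `a ≤ b` once `m ≤ 2a+1`. [folklore] -/
private theorem choose_anti {m a b : ℕ} (ha : m ≤ 2 * a + 1) (hab : a ≤ b) : m.choose b ≤ m.choose a := by
  induction b, hab using Nat.le_induction with
  | base => exact le_rfl
  | succ b hab ih => exact (choose_succ_le_of_le (by omega)).trans ih

/-- The ratio recurrence in `ℝ`: `C(m, i+1)·(i+1) = C(m, i)·(m−i)`. [folklore] -/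
private theorem choose_succ_mul_cast (m i : ℕ) :
    ((m.choose (i + 1) : ℕ) : ℝ) * ((i : ℝ) + 1) = (m.choose i : ℝ) * ((m - i : ℕ) : ℝ) := by
  exact_mod_cast Nat.choose_succ_right_eq m i

/-- **Lemma 6, first step** (“`C(2n, n+δ)/C(2n, n) = (n−δ+1)/(n+1) ⋯ n/(n+δ) > (1 − δ/n)^δ`”):
`((n−δ)/n)^δ · C(2n, n) ≤ C(2n, n+δ)` for `δ ≤ n`. [cite: HirvonenRybickiSchmidSuomela2017,
Appendix A, Lemma 6 (proof)] -/
theorem choose_middle_add_ge {n δ : ℕ} (hδ : δ ≤ n) (hn : 0 < n) :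
    (((n : ℝ) - δ) / n) ^ δ * ((2 * n).choose n : ℝ) ≤ ((2 * n).choose (n + δ) : ℝ) := by
  -- factorial identities
  have h1 : (((2 * n).choose (n + δ) : ℕ) : ℝ) * ((n + δ).factorial : ℝ) * ((n - δ).factorial : ℝ)
      = ((2 * n).factorial : ℝ) := by
    have h0 := Nat.choose_mul_factorial_mul_factorial (show n + δ ≤ 2 * n by omega)
    rw [show 2 * n - (n + δ) = n - δ by omega] at h0
    exact_mod_cast h0
  have h2 : (((2 * n).choose n : ℕ) : ℝ) * (n.factorial : ℝ) * (n.factorial : ℝ)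
      = ((2 * n).factorial : ℝ) := by
    have h0 := Nat.choose_mul_factorial_mul_factorial (show n ≤ 2 * n by omega)
    rw [show 2 * n - n = n by omega] at h0
    exact_mod_cast h0
  have h3 : (n.factorial : ℝ) * ((n + 1).ascFactorial δ : ℝ) = ((n + δ).factorial : ℝ) := by
    exact_mod_cast Nat.factorial_mul_ascFactorial n δ
  have h4 : ((n - δ).factorial : ℝ) * (n.descFactorial δ : ℝ) = (n.factorial : ℝ) := by
    exact_mod_cast Nat.factorial_mul_descFactorial hδ
  set C₁ : ℝ := (((2 * n).choose (n + δ) : ℕ) : ℝ)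
  set C₀ : ℝ := (((2 * n).choose n : ℕ) : ℝ)
  set A : ℝ := ((n + 1).ascFactorial δ : ℝ) with hA
  set D : ℝ := (n.descFactorial δ : ℝ) with hD
  have hF : (n.factorial : ℝ) * ((n - δ).factorial : ℝ) ≠ 0 := by positivity
  have hCA : C₁ * A = C₀ * D := by
    have : (n.factorial : ℝ) * ((n - δ).factorial : ℝ) * (C₁ * A - C₀ * D) = 0 := by
      linear_combination C₁ * ((n - δ).factorial : ℝ) * h3 + h1 - C₀ * (n.factorial : ℝ) * h4 - h2
    rcases mul_eq_zero.1 this with h | h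
    · exact absurd h hF
    · linarith
  have hApos : 0 < A := by
    rw [hA]; exact_mod_cast Nat.ascFactorial_pos _ _
  -- the product comparison `D · n^δ ≥ (n−δ)^δ · A`
  have hDprod : D = ∏ i ∈ range δ, ((n : ℝ) - i) := by
    rw [hD, Nat.descFactorial_eq_prod_range, Nat.cast_prod]
    refine prod_congr rfl fun i hi => ?_
    rw [mem_range] at hi
    rw [Nat.cast_sub (by omega)]
  have hAprod : A = ∏ i ∈ range δ, ((n : ℝ) + δ - i) := by
    rw [hA, Nat.ascFactorial_eq_prod_range, Nat.cast_prod,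
      ← prod_range_reflect (fun i => ((n : ℝ) + δ - i)) δ]
    refine prod_congr rfl fun i hi => ?_
    rw [mem_range] at hi
    push_cast
    rw [Nat.cast_sub (by omega), Nat.cast_sub (by omega)]
    push_cast
    ring
  have hcmp : ((n : ℝ) - δ) ^ δ * A ≤ D * (n : ℝ) ^ δ := by
    have e1 : ((n : ℝ) - δ) ^ δ * A = ∏ i ∈ range δ, (((n : ℝ) - δ) * ((n : ℝ) + δ - i)) := by
      rw [hAprod, prod_mul_distrib, prod_const, card_range]
    have e2 : D * (n : ℝ) ^ δ = ∏ i ∈ range δ, (((n : ℝ) - i) * n) := by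
      rw [hDprod, prod_mul_distrib, prod_const, card_range]
    rw [e1, e2]
    refine prod_le_prod (fun i hi => ?_) (fun i hi => ?_)
    · rw [mem_range] at hi
      have : (δ : ℝ) ≤ n := by exact_mod_cast hδ
      have : (i : ℝ) < δ := by exact_mod_cast hi
      nlinarith
    · rw [mem_range] at hi
      have hiδ : (i : ℝ) ≤ δ := by exact_mod_cast hi.le
      have : (δ : ℝ) ≤ n := by exact_mod_cast hδ
      nlinarith
  -- conclude
  have hnpow : (0 : ℝ) < (n : ℝ) ^ δ := by positivity
  have hC₀ : 0 ≤ C₀ := by positivity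
  rw [div_pow]
  calc ((n : ℝ) - δ) ^ δ / (n : ℝ) ^ δ * C₀
      = (((n : ℝ) - δ) ^ δ * A) * (C₀ / (A * (n : ℝ) ^ δ)) := by
        field_simp
    _ ≤ (D * (n : ℝ) ^ δ) * (C₀ / (A * (n : ℝ) ^ δ)) :=
        mul_le_mul_of_nonneg_right hcmp (by positivity)
    _ = C₀ * D / A := by field_simp
    _ = C₁ := by rw [← hCA]; field_simp


/-! ## Lemma 6 — `C(2n, n+δ_j(n)) > 0.995 · g_j · C(2n, n)` -/

/-- **Lemma 6, second step**: `h(δ) = (1 − c/δ)^δ` is non-decreasing in `δ ≥ c` (“Now `h_j(δ) → g_j`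
as `δ → ∞`”; the monotonicity, implicit in the paper, is Bernoulli's inequality). [cite:
HirvonenRybickiSchmidSuomela2017, Appendix A, Lemma 6 (proof)] -/
theorem one_sub_div_pow_le_succ {c : ℝ} (hc : 0 ≤ c) {δ : ℕ} (hcδ : c ≤ δ) (hδ : 0 < δ) :
    (1 - c / δ) ^ δ ≤ (1 - c / (δ + 1)) ^ (δ + 1) := by
  have hδ' : (0 : ℝ) < δ := by exact_mod_cast hδ
  rcases hcδ.eq_or_lt with h | h
  · -- `c = δ`: the left-hand side vanishes
    rw [h, div_self hδ'.ne', sub_self, zero_pow hδ.ne']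
    apply pow_nonneg
    rw [sub_nonneg, div_le_one (by positivity)]
    linarith
  · set a : ℝ := c / ((δ + 1) * (δ - c)) with ha
    have hdc : (0 : ℝ) < δ - c := by linarith
    have ha0 : 0 ≤ a := by positivity
    have key : 1 - c / (δ + 1) = (1 - c / δ) * (1 + a) := by
      rw [ha]; field_simp; ring
    have hB : (δ : ℝ) / (δ - c) ≤ (1 + a) ^ (δ + 1) := by
      have hb := one_add_mul_le_pow (show (-2 : ℝ) ≤ a by linarith) (δ + 1)
      have e : 1 + ((δ + 1 : ℕ) : ℝ) * a = δ / (δ - c) := by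
        rw [ha]; push_cast; field_simp; ring
      rwa [e] at hb
    have h1 : 0 ≤ 1 - c / δ := by
      rw [sub_nonneg, div_le_one hδ']; exact hcδ
    calc (1 - c / δ) ^ δ = (1 - c / δ) ^ δ * ((1 - c / δ) * (δ / (δ - c))) := by
          rw [show (1 - c / (δ : ℝ)) * (δ / (δ - c)) = 1 by field_simp, mul_one]
      _ = (1 - c / δ) ^ (δ + 1) * (δ / (δ - c)) := by ring
      _ ≤ (1 - c / δ) ^ (δ + 1) * (1 + a) ^ (δ + 1) :=
          mul_le_mul_of_nonneg_left hB (pow_nonneg h1 _)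
      _ = (1 - c / (δ + 1)) ^ (δ + 1) := by rw [key, mul_pow]

/-- Hence `h(δ₀) ≤ h(δ)` for `c ≤ δ₀ ≤ δ`. [cite: HirvonenRybickiSchmidSuomela2017, Appendix A,
Lemma 6 (proof: “`h_j(δ) > 0.995 · g_j` when `δ ≥ δ_j(1500)`”)] -/
theorem one_sub_div_pow_mono {c : ℝ} (hc : 0 ≤ c) {δ₀ δ : ℕ} (hcδ : c ≤ δ₀) (hδ₀ : 0 < δ₀)
    (hle : δ₀ ≤ δ) : (1 - c / δ₀) ^ δ₀ ≤ (1 - c / δ) ^ δ := by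
  induction δ, hle using Nat.le_induction with
  | base => exact le_rfl
  | succ δ hle ih =>
      refine ih.trans ?_
      have hcδ' : c ≤ δ := hcδ.trans (by exact_mod_cast hle)
      have := one_sub_div_pow_le_succ hc hcδ' (by omega)
      push_cast
      exact this

/-- `δ_j(n) = ⌊j √(n/32)⌋`, computed as the integer square root of `⌊j² n/32⌋` (the two floors
agree since `(δ+1)²` is an integer). [cite: HirvonenRybickiSchmidSuomela2017, Appendix A
(“`δ_j(n) = ⌊j √(n/32)⌋`”)] -/
def dlt (j n : ℕ) : ℕ := Nat.sqrt (j ^ 2 * n / 32)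

/-- `32 δ_j(n)² ≤ j² n`. [folklore] -/
private theorem dlt_sq_le (j n : ℕ) : 32 * dlt j n ^ 2 ≤ j ^ 2 * n := by
  have h1 := Nat.sqrt_le' (j ^ 2 * n / 32)
  have h2 := Nat.div_mul_le_self (j ^ 2 * n) 32
  unfold dlt
  calc 32 * Nat.sqrt (j ^ 2 * n / 32) ^ 2 ≤ 32 * (j ^ 2 * n / 32) := Nat.mul_le_mul_left _ h1
    _ = j ^ 2 * n / 32 * 32 := by ring
    _ ≤ j ^ 2 * n := h2

/-- `j² n < 32 (δ_j(n)+1)²`. [folklore] -/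
private theorem lt_dlt_succ_sq (j n : ℕ) : j ^ 2 * n < 32 * (dlt j n + 1) ^ 2 := by
  have h1 : j ^ 2 * n / 32 < (dlt j n + 1) ^ 2 := Nat.lt_succ_sqrt' _
  have h2 : j ^ 2 * n < 32 * (j ^ 2 * n / 32 + 1) := by omega
  calc j ^ 2 * n < 32 * (j ^ 2 * n / 32 + 1) := h2
    _ ≤ 32 * (dlt j n + 1) ^ 2 := Nat.mul_le_mul_left _ (Nat.succ_le_of_lt h1)

/-- `δ_j(n)` is monotone in `n`. [folklore] -/
private theorem dlt_mono_right (j : ℕ) {n n' : ℕ} (h : n ≤ n') : dlt j n ≤ dlt j n' := by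
  unfold dlt
  exact Nat.sqrt_le_sqrt (Nat.div_le_div_right (Nat.mul_le_mul_left _ h))

/-- `δ_j(n)` is monotone in `j`. [folklore] -/
private theorem dlt_mono_left (n : ℕ) {j j' : ℕ} (h : j ≤ j') : dlt j n ≤ dlt j' n := by
  unfold dlt
  exact Nat.sqrt_le_sqrt (Nat.div_le_div_right (Nat.mul_le_mul_right _
    (Nat.pow_le_pow_left h 2)))

/-- `δ_j(n) ≤ j √(n/32)`. [cite: HirvonenRybickiSchmidSuomela2017, Appendix A] -/
theorem dlt_le_real (j n : ℕ) : (dlt j n : ℝ) ≤ j * Real.sqrt (n / 32) := by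
  refine le_of_pow_le_pow_left₀ two_ne_zero (by positivity) ?_
  rw [mul_pow, Real.sq_sqrt (by positivity)]
  have := dlt_sq_le j n
  have h : (32 : ℝ) * (dlt j n : ℝ) ^ 2 ≤ (j : ℝ) ^ 2 * n := by exact_mod_cast this
  linarith

/-- `j √(n/32) < δ_j(n) + 1` (“`δ_j(n) > j √(n/32) − 1`”). [cite: HirvonenRybickiSchmidSuomela2017,
Appendix A, Lemma 7 (proof)] -/
theorem real_lt_dlt_succ (j n : ℕ) : j * Real.sqrt (n / 32) < (dlt j n : ℝ) + 1 := by
  refine lt_of_pow_lt_pow_left₀ 2 (by positivity) ?_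
  rw [mul_pow, Real.sq_sqrt (by positivity)]
  have := lt_dlt_succ_sq j n
  have h : (j : ℝ) ^ 2 * n < (32 : ℝ) * ((dlt j n : ℝ) + 1) ^ 2 := by exact_mod_cast this
  linarith

/-- `2 δ_4(n)² ≤ n`, i.e. `δ_4(n) = ⌊√(n/2)⌋ ≤ √(n/2)`. [cite: HirvonenRybickiSchmidSuomela2017,
Appendix A] -/
theorem two_mul_dlt_four_sq_le (n : ℕ) : 2 * dlt 4 n ^ 2 ≤ n := by
  have := dlt_sq_le 4 n
  omega

/-- `δ_4(n) ≤ n`. [folklore] -/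
private theorem dlt_four_le (n : ℕ) : dlt 4 n ≤ n := by
  have h := two_mul_dlt_four_sq_le n
  nlinarith [Nat.zero_le (dlt 4 n)]

/-- The values `δ_j(1500) = 6, 13, 20, 27` for `j = 1, 2, 3, 4`. [cite:
HirvonenRybickiSchmidSuomela2017, Appendix A, Lemma 6 (proof)] -/
theorem dlt_1500 : dlt 1 1500 = 6 ∧ dlt 2 1500 = 13 ∧ dlt 3 1500 = 20 ∧ dlt 4 1500 = 27 := by
  unfold dlt
  refine ⟨?_, ?_, ?_, ?_⟩ <;>
    exact (Nat.eq_sqrt.2 ⟨by norm_num, by norm_num⟩).symm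

/-- `g_j = e^{-j²/32}`. [cite: HirvonenRybickiSchmidSuomela2017, Appendix A (“`g_j = e^{−j²/32}`”)] -/
def g (j : ℕ) : ℝ := Real.exp (-((j : ℝ) ^ 2 / 32))

/-- `g_j > 0`. [folklore] -/
private theorem g_pos (j : ℕ) : 0 < g j := Real.exp_pos _

/-- `g_j ≤ 1`. [folklore] -/
private theorem g_le_one (j : ℕ) : g j ≤ 1 := by
  unfold g
  rw [Real.exp_le_one_iff]
  have : (0 : ℝ) ≤ (j : ℝ) ^ 2 / 32 := by positivity
  linarith

/-- Upper bound for `e^{-a}` by a truncated series of `e^{a}`: `e^{-a} ≤ 1 / Σ_{i<k} a^i/i!`.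
[folklore] -/
private theorem exp_neg_le_inv_sum {a : ℝ} (ha : 0 ≤ a) (k : ℕ) (hk : 0 < k) :
    Real.exp (-a) ≤ 1 / ∑ i ∈ range k, a ^ i / i.factorial := by
  have hs : 0 < ∑ i ∈ range k, a ^ i / i.factorial := by
    obtain ⟨k, rfl⟩ := Nat.exists_eq_succ_of_ne_zero hk.ne'
    rw [sum_range_succ']
    simp only [pow_zero, Nat.factorial_zero, Nat.cast_one, div_one]
    have : 0 ≤ ∑ i ∈ range k, a ^ (i + 1) / (i + 1).factorial :=
      sum_nonneg fun i _ => by positivity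
    linarith
  rw [Real.exp_neg, le_div_iff₀ hs, inv_mul_le_iff₀ (Real.exp_pos a), mul_one]
  exact Real.sum_le_exp_of_nonneg ha k

/-- Lower bound for `e^{-a}`, `0 ≤ a ≤ 1`, by the truncated series with Mathlib's remainder
estimate: `e^{-a} ≥ Σ_{i<k} (−a)^i/i! − a^k (k+1)/(k!·k)`. [folklore] -/
private theorem sum_sub_le_exp_neg {a : ℝ} (ha : 0 ≤ a) (ha1 : a ≤ 1) (k : ℕ) (hk : 0 < k) :
    ∑ i ∈ range k, (-a) ^ i / i.factorial - a ^ k * ((k + 1 : ℝ) / (k.factorial * k)) ≤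
      Real.exp (-a) := by
  have h := Real.exp_bound (x := -a) (by rw [abs_neg, abs_of_nonneg ha]; exact ha1) hk
  rw [abs_neg, abs_of_nonneg ha] at h
  have := (abs_sub_le_iff.1 h).2
  push_cast at this ⊢
  linarith

/-- **Lemma 6 (HRSS).** For `j ∈ {1,2,3,4}`, `δ = δ_j(n)` and `n ≥ 1500`:
`C(2n, n+δ) > 0.995 · g_j · C(2n, n)` (here with `≥`). Proof as printed: the ratio is at least
`(1 − δ/n)^δ ≥ h_j(δ) = (1 − j²/(32δ))^δ ≥ h_j(δ_j(1500))`, and the four numerical facts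
`h_j(δ_j(1500)) > 0.995 g_j` (checked here against a truncated exponential series). [cite:
HirvonenRybickiSchmidSuomela2017, Appendix A, Lemma 6] -/
theorem hrss_lemma6 {j n : ℕ} (hj : j ∈ Finset.Icc 1 4) (hn : 1500 ≤ n) :
    0.995 * g j * ((2 * n).choose n : ℝ) ≤ ((2 * n).choose (n + dlt j n) : ℝ) := by
  set δ := dlt j n with hδdef
  have hj' : 1 ≤ j ∧ j ≤ 4 := by simpa using hj
  have hδ4 : δ ≤ dlt 4 n := dlt_mono_left n hj'.2
  have hδn : δ ≤ n := hδ4.trans (dlt_four_le n)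
  have hn0 : 0 < n := by omega
  have hnR : (0 : ℝ) < n := by exact_mod_cast hn0
  -- δ ≥ δ_j(1500) ≥ 6
  set δ₀ := dlt j 1500 with hδ₀def
  have hδ₀le : δ₀ ≤ δ := dlt_mono_right j hn
  have hδ₀6 : 6 ≤ δ₀ := by
    have := dlt_mono_left 1500 hj'.1
    rw [dlt_1500.1] at this
    exact this
  have hδpos : 0 < δ := by omega
  have hδR : (0 : ℝ) < δ := by exact_mod_cast hδpos
  set c : ℝ := (j : ℝ) ^ 2 / 32 with hcdef
  have hc0 : 0 ≤ c := by positivity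
  have hc1 : c ≤ 1 / 2 := by
    rw [hcdef]
    have : (j : ℝ) ≤ 4 := by exact_mod_cast hj'.2
    have : (j : ℝ) ^ 2 ≤ 16 := by nlinarith
    linarith
  have hcδ₀ : c ≤ δ₀ := by
    have : (6 : ℝ) ≤ δ₀ := by exact_mod_cast hδ₀6
    linarith
  -- step 1: the ratio bound
  have s1 := choose_middle_add_ge hδn hn0
  -- step 2: `(n−δ)/n ≥ 1 − c/δ`
  have s2 : 1 - c / δ ≤ ((n : ℝ) - δ) / n := by
    have hsq : (32 : ℝ) * (δ : ℝ) ^ 2 ≤ (j : ℝ) ^ 2 * n := by exact_mod_cast dlt_sq_le j n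
    have e1 : ((n : ℝ) - δ) / n = 1 - δ / n := by field_simp
    have e2 : (δ : ℝ) / n ≤ c / δ := by
      rw [div_le_div_iff₀ hnR hδR, hcdef]
      nlinarith
    rw [e1]
    linarith
  have hδ6 : (6 : ℝ) ≤ δ := by exact_mod_cast (hδ₀6.trans hδ₀le)
  have h1cδ : (0 : ℝ) ≤ 1 - c / δ := by
    rw [sub_nonneg, div_le_one hδR]; linarith
  have s2' : (1 - c / δ) ^ δ ≤ (((n : ℝ) - δ) / n) ^ δ := pow_le_pow_left₀ h1cδ s2 δ
  -- step 3: monotonicity down to δ₀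
  have s3 : (1 - c / δ₀) ^ δ₀ ≤ (1 - c / δ) ^ δ := one_sub_div_pow_mono hc0 hcδ₀ (by omega) hδ₀le
  -- step 4: numerics at δ₀
  have s4 : 0.995 * g j ≤ (1 - c / δ₀) ^ δ₀ := by
    rw [hcdef, hδ₀def]
    obtain ⟨h1, h2, h3, h4⟩ := dlt_1500
    have hj1 : j = 1 ∨ j = 2 ∨ j = 3 ∨ j = 4 := by omega
    rcases hj1 with rfl | rfl | rfl | rfl
    · rw [h1]
      have hb := exp_neg_le_inv_sum (show (0:ℝ) ≤ (1:ℕ)^2/32 by positivity) 4 (by norm_num)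
      refine (mul_le_mul_of_nonneg_left hb (by norm_num)).trans ?_
      simp only [sum_range_succ, sum_range_zero, Nat.factorial]
      norm_num
    · rw [h2]
      have hb := exp_neg_le_inv_sum (show (0:ℝ) ≤ (2:ℕ)^2/32 by positivity) 5 (by norm_num)
      refine (mul_le_mul_of_nonneg_left hb (by norm_num)).trans ?_
      simp only [sum_range_succ, sum_range_zero, Nat.factorial]
      norm_num
    · rw [h3]
      have hb := exp_neg_le_inv_sum (show (0:ℝ) ≤ (3:ℕ)^2/32 by positivity) 6 (by norm_num)
      refine (mul_le_mul_of_nonneg_left hb (by norm_num)).trans ?_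
      simp only [sum_range_succ, sum_range_zero, Nat.factorial]
      norm_num
    · rw [h4]
      have hb := exp_neg_le_inv_sum (show (0:ℝ) ≤ (4:ℕ)^2/32 by positivity) 7 (by norm_num)
      refine (mul_le_mul_of_nonneg_left hb (by norm_num)).trans ?_
      simp only [sum_range_succ, sum_range_zero, Nat.factorial]
      norm_num
  -- chain
  have hC : (0 : ℝ) ≤ ((2 * n).choose n : ℝ) := by positivity
  calc 0.995 * g j * ((2 * n).choose n : ℝ)
      ≤ (((n : ℝ) - δ) / n) ^ δ * ((2 * n).choose n : ℝ) :=
        mul_le_mul_of_nonneg_right (s4.trans (s3.trans s2')) hC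
    _ ≤ _ := s1


/-! ## Lemma 7 — the mass of `C(2n, n+i)`, `−δ_4(n) < i ≤ δ_4(n)` -/

/-- `δ_0(n) = 0`. [folklore] -/
private theorem dlt_zero (n : ℕ) : dlt 0 n = 0 := by
  simp [dlt]

/-- `g_j` is non-increasing in `j`. [folklore] -/
private theorem g_anti {j j' : ℕ} (h : j ≤ j') : g j' ≤ g j := by
  unfold g
  rw [Real.exp_le_exp]
  have : (j : ℝ) ≤ j' := by exact_mod_cast h
  have : (j : ℝ) ^ 2 ≤ (j' : ℝ) ^ 2 := by nlinarith
  linarith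

/-- A block of the lower Riemann sum: on `n + a < i ≤ n + b` every `C(2n, i) ≥ C(2n, n+b)`, so the
block contributes at least `(b − a) · C(2n, n+b)`. [cite: HirvonenRybickiSchmidSuomela2017,
Appendix A, Lemma 7 (proof, first inequality)] -/
theorem block_sum_ge (n a b : ℕ) (hab : a ≤ b) :
    ((b - a : ℕ) : ℝ) * ((2 * n).choose (n + b) : ℝ) ≤
      ∑ i ∈ Ioc (n + a) (n + b), ((2 * n).choose i : ℝ) := by
  have h := Finset.card_nsmul_le_sum (Ioc (n + a) (n + b)) (fun i => ((2 * n).choose i : ℝ))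
    ((2 * n).choose (n + b) : ℝ) (fun i hi => by
      rw [mem_Ioc] at hi
      exact_mod_cast choose_anti (m := 2 * n) (a := i) (by omega) hi.2)
  rw [Nat.card_Ioc, nsmul_eq_mul] at h
  rw [show n + b - (n + a) = b - a by omega] at h
  exact h

/-- **Lemma 7, main estimate** (“`4^{-n} Σ_{i=1}^{δ} C(2n, n+i) ≥ … ≥ 0.995 · 4^{-n} C(2n,n) ·
Σ_j (δ_j(n) − δ_{j−1}(n)) g_j > …`”): the four-block lower Riemann sum with Abel summation,
`Σ_{i=1}^{δ_4(n)} C(2n, n+i) ≥ 0.995 · C(2n, n) · (√(n/32) · (g_1+g_2+g_3+g_4) − g_1)`. [cite: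
HirvonenRybickiSchmidSuomela2017, Appendix A, Lemma 7 (proof)] -/
theorem sum_upper_blocks_ge {n : ℕ} (hn : 1500 ≤ n) :
    0.995 * ((2 * n).choose n : ℝ) *
        (Real.sqrt (n / 32) * (g 1 + g 2 + g 3 + g 4) - g 1) ≤
      ∑ i ∈ Ioc n (n + dlt 4 n), ((2 * n).choose i : ℝ) := by
  set s := Real.sqrt (n / 32) with hs
  have hC0 : (0 : ℝ) ≤ ((2 * n).choose n : ℝ) := by positivity
  have m12 : dlt 1 n ≤ dlt 2 n := dlt_mono_left n (by norm_num)
  have m23 : dlt 2 n ≤ dlt 3 n := dlt_mono_left n (by norm_num)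
  have m34 : dlt 3 n ≤ dlt 4 n := dlt_mono_left n (by norm_num)
  -- split into the four blocks
  have hsplit : ∑ i ∈ Ioc n (n + dlt 4 n), ((2 * n).choose i : ℝ) =
      ∑ i ∈ Ioc n (n + dlt 1 n), ((2 * n).choose i : ℝ) +
      ∑ i ∈ Ioc (n + dlt 1 n) (n + dlt 2 n), ((2 * n).choose i : ℝ) +
      ∑ i ∈ Ioc (n + dlt 2 n) (n + dlt 3 n), ((2 * n).choose i : ℝ) +
      ∑ i ∈ Ioc (n + dlt 3 n) (n + dlt 4 n), ((2 * n).choose i : ℝ) := by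
    rw [sum_Ioc_consecutive _ (by omega) (by omega), sum_Ioc_consecutive _ (by omega) (by omega),
      sum_Ioc_consecutive _ (by omega) (by omega)]
  -- each block
  have b1 := (mul_le_mul_of_nonneg_left (hrss_lemma6 (j := 1) (by simp) hn)
    (Nat.cast_nonneg (dlt 1 n - 0))).trans (block_sum_ge n 0 (dlt 1 n) (Nat.zero_le _))
  have b2 := (mul_le_mul_of_nonneg_left (hrss_lemma6 (j := 2) (by simp) hn)
    (Nat.cast_nonneg (dlt 2 n - dlt 1 n))).trans (block_sum_ge n _ _ m12)
  have b3 := (mul_le_mul_of_nonneg_left (hrss_lemma6 (j := 3) (by simp) hn)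
    (Nat.cast_nonneg (dlt 3 n - dlt 2 n))).trans (block_sum_ge n _ _ m23)
  have b4 := (mul_le_mul_of_nonneg_left (hrss_lemma6 (j := 4) (by simp) hn)
    (Nat.cast_nonneg (dlt 4 n - dlt 3 n))).trans (block_sum_ge n _ _ m34)
  rw [Nat.sub_zero, add_zero] at b1
  rw [Nat.cast_sub m12] at b2
  rw [Nat.cast_sub m23] at b3
  rw [Nat.cast_sub m34] at b4
  -- Abel summation with `δ_j > j s − 1` and `g_1 ≥ g_2 ≥ g_3 ≥ g_4 ≥ 0`
  have l1 : (1 : ℕ) * s < dlt 1 n + 1 := real_lt_dlt_succ 1 n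
  have l2 : (2 : ℕ) * s < dlt 2 n + 1 := real_lt_dlt_succ 2 n
  have l3 : (3 : ℕ) * s < dlt 3 n + 1 := real_lt_dlt_succ 3 n
  have l4 : (4 : ℕ) * s < dlt 4 n + 1 := real_lt_dlt_succ 4 n
  push_cast at l1 l2 l3 l4
  have g12 : g 2 ≤ g 1 := g_anti (by norm_num)
  have g23 : g 3 ≤ g 2 := g_anti (by norm_num)
  have g34 : g 4 ≤ g 3 := g_anti (by norm_num)
  have g4 : 0 ≤ g 4 := (g_pos 4).le
  have hAbel : s * (g 1 + g 2 + g 3 + g 4) - g 1 ≤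
      (dlt 1 n : ℝ) * g 1 + ((dlt 2 n : ℝ) - dlt 1 n) * g 2 +
        ((dlt 3 n : ℝ) - dlt 2 n) * g 3 + ((dlt 4 n : ℝ) - dlt 3 n) * g 4 := by
    nlinarith [mul_nonneg (show (0:ℝ) ≤ dlt 1 n + 1 - s by linarith) (sub_nonneg.2 g12),
      mul_nonneg (show (0:ℝ) ≤ dlt 2 n + 1 - 2 * s by linarith) (sub_nonneg.2 g23),
      mul_nonneg (show (0:ℝ) ≤ dlt 3 n + 1 - 3 * s by linarith) (sub_nonneg.2 g34),
      mul_nonneg (show (0:ℝ) ≤ dlt 4 n + 1 - 4 * s by linarith) g4]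
  have h995 : (0 : ℝ) ≤ 0.995 * ((2 * n).choose n : ℝ) := by positivity
  calc 0.995 * ((2 * n).choose n : ℝ) * (s * (g 1 + g 2 + g 3 + g 4) - g 1)
      ≤ 0.995 * ((2 * n).choose n : ℝ) * ((dlt 1 n : ℝ) * g 1 + ((dlt 2 n : ℝ) - dlt 1 n) * g 2 +
        ((dlt 3 n : ℝ) - dlt 2 n) * g 3 + ((dlt 4 n : ℝ) - dlt 3 n) * g 4) :=
        mul_le_mul_of_nonneg_left hAbel h995
    _ = (dlt 1 n : ℝ) * (0.995 * g 1 * ((2 * n).choose n : ℝ)) +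
        ((dlt 2 n : ℝ) - dlt 1 n) * (0.995 * g 2 * ((2 * n).choose n : ℝ)) +
        ((dlt 3 n : ℝ) - dlt 2 n) * (0.995 * g 3 * ((2 * n).choose n : ℝ)) +
        ((dlt 4 n : ℝ) - dlt 3 n) * (0.995 * g 4 * ((2 * n).choose n : ℝ)) := by ring
    _ ≤ _ := by rw [hsplit]; linarith [b1, b2, b3, b4]

/-- Numerics: `g_1 + g_2 + g_3 + g_4 ≥ 3.21309` (true value `3.213100…`). [cite:
HirvonenRybickiSchmidSuomela2017, Appendix A, Lemma 7 (proof: “`Σ_j g_j √(n/32) − g_1 >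
0.5680 √n − 0.9693`”)] -/
theorem g_sum_ge : 3.21309 ≤ g 1 + g 2 + g 3 + g 4 := by
  have e1 := sum_sub_le_exp_neg (show (0:ℝ) ≤ (1:ℕ)^2/32 by positivity) (by norm_num) 8 (by norm_num)
  have e2 := sum_sub_le_exp_neg (show (0:ℝ) ≤ (2:ℕ)^2/32 by positivity) (by norm_num) 8 (by norm_num)
  have e3 := sum_sub_le_exp_neg (show (0:ℝ) ≤ (3:ℕ)^2/32 by positivity) (by norm_num) 8 (by norm_num)
  have e4 := sum_sub_le_exp_neg (show (0:ℝ) ≤ (4:ℕ)^2/32 by positivity) (by norm_num) 8 (by norm_num)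
  simp only [sum_range_succ, sum_range_zero, Nat.factorial] at e1 e2 e3 e4
  unfold g
  norm_num at e1 e2 e3 e4 ⊢
  linarith

/-- Numerics: `g_1 ≤ 0.96924`. [cite: HirvonenRybickiSchmidSuomela2017, Appendix A, Lemma 7
(proof, the constant `0.9693`)] -/
theorem g_one_le : g 1 ≤ 0.96924 := by
  have hb := exp_neg_le_inv_sum (show (0:ℝ) ≤ (1:ℕ)^2/32 by positivity) 4 (by norm_num)
  simp only [sum_range_succ, sum_range_zero, Nat.factorial] at hb
  unfold g
  norm_num at hb ⊢
  linarith

/-- **Lemma 7, the half-sum** (“`4^{-n} Σ_{i=1}^{δ} C(2n, n+i) > 0.3185 − 0.5436/√n > 0.3044`”):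
with Wallis' bound in place of `0.999/√(πn)` we get `≥ 0.3045 · 4^n` for `n ≥ 1500`. [cite:
HirvonenRybickiSchmidSuomela2017, Appendix A, Lemma 7 (proof)] -/
theorem hrss_lemma7_half {n : ℕ} (hn : 1500 ≤ n) :
    0.3045 * (4 : ℝ) ^ n ≤ ∑ i ∈ Ioc n (n + dlt 4 n), ((2 * n).choose i : ℝ) := by
  have hmain := sum_upper_blocks_ge hn
  have hnR : (1500 : ℝ) ≤ n := by exact_mod_cast hn
  set s := Real.sqrt (n / 32) with hs
  set G := g 1 + g 2 + g 3 + g 4 with hG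
  have hGge := g_sum_ge
  have hg1 := g_one_le
  have hg1pos := g_pos 1
  set ℓ := Real.sqrt (2 / (π * (2 * n + 1))) with hℓ
  have hℓ0 : 0 ≤ ℓ := Real.sqrt_nonneg _
  -- `ℓ s ≥ 0.0997` and `ℓ ≤ 0.01457`
  have hℓs : 0.0997 ≤ ℓ * s := by
    rw [hℓ, hs, ← Real.sqrt_mul (by positivity)]
    rw [show (0.0997 : ℝ) = Real.sqrt (0.0997 ^ 2) by rw [Real.sqrt_sq (by norm_num)]]
    refine Real.sqrt_le_sqrt ?_
    rw [div_mul_div_comm, le_div_iff₀ (by positivity)]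
    nlinarith [Real.pi_lt_d6, Real.pi_pos]
  have hℓle : ℓ ≤ 0.01457 := by
    rw [hℓ, show (0.01457 : ℝ) = Real.sqrt (0.01457 ^ 2) by rw [Real.sqrt_sq (by norm_num)]]
    refine Real.sqrt_le_sqrt ?_
    rw [div_le_iff₀ (by positivity)]
    nlinarith [Real.pi_gt_d6]
  -- `C(2n,n) = cbin n · 4^n ≥ ℓ · 4^n`
  have hCeq : ((2 * n).choose n : ℝ) = cbin n * 4 ^ n := by
    unfold cbin; field_simp
  have hcb := sqrt_le_cbin n
  rw [← hℓ] at hcb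
  have h4 : (0 : ℝ) < 4 ^ n := by positivity
  have hs6 : 6 ≤ s := by
    rw [hs, show (6 : ℝ) = Real.sqrt (6 ^ 2) by rw [Real.sqrt_sq (by norm_num)]]
    exact Real.sqrt_le_sqrt (by rw [le_div_iff₀ (by norm_num)]; nlinarith)
  have hpos : 0 ≤ s * G - g 1 := by nlinarith
  calc 0.3045 * (4 : ℝ) ^ n ≤ 0.995 * (0.0997 * G - 0.01457 * g 1) * 4 ^ n := by
        nlinarith
    _ ≤ 0.995 * (ℓ * (s * G - g 1)) * 4 ^ n := by
        have : 0.0997 * G - 0.01457 * g 1 ≤ ℓ * (s * G - g 1) := by nlinarith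
        nlinarith
    _ ≤ 0.995 * (cbin n * (s * G - g 1)) * 4 ^ n := by
        have : ℓ * (s * G - g 1) ≤ cbin n * (s * G - g 1) := mul_le_mul_of_nonneg_right hcb hpos
        nlinarith
    _ = 0.995 * ((2 * n).choose n : ℝ) * (s * G - g 1) := by rw [hCeq]; ring
    _ ≤ _ := hmain

/-- Reflection about the middle: `Σ_{n−δ < i ≤ n} C(2n, i) = Σ_{n ≤ i < n+δ} C(2n, i)`
(`C(2n, n−i) = C(2n, n+i)`). [cite: HirvonenRybickiSchmidSuomela2017, Appendix A, Lemma 7 (proof: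
“the claim follows from the observations …”)] -/
theorem sum_Ioc_reflect {n δ : ℕ} (hδ : δ ≤ n) :
    ∑ i ∈ Ioc (n - δ) n, ((2 * n).choose i : ℝ) = ∑ i ∈ Ico n (n + δ), ((2 * n).choose i : ℝ) := by
  refine Finset.sum_nbij' (fun i => 2 * n - i) (fun i => 2 * n - i) ?_ ?_ ?_ ?_ ?_
  · intro i hi; simp only [mem_Ioc, mem_Ico] at hi ⊢; omega
  · intro i hi; simp only [mem_Ioc, mem_Ico] at hi ⊢; omega
  · intro i hi; simp only [mem_Ioc] at hi; omega
  · intro i hi; simp only [mem_Ico] at hi; omega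
  · intro i hi
    simp only [mem_Ioc] at hi
    rw [Nat.choose_symm (by omega : i ≤ 2 * n)]

/-- Shift by one: `Σ_{n < i ≤ n+δ} C(2n, i) ≤ Σ_{n ≤ i < n+δ} C(2n, i)` (termwise, past the middle).
[cite: HirvonenRybickiSchmidSuomela2017, Appendix A, Lemma 7 (proof)] -/
theorem sum_Ioc_le_sum_Ico (n δ : ℕ) :
    ∑ i ∈ Ioc n (n + δ), ((2 * n).choose i : ℝ) ≤ ∑ i ∈ Ico n (n + δ), ((2 * n).choose i : ℝ) := by
  have h : ∑ i ∈ Ioc n (n + δ), ((2 * n).choose i : ℝ) =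
      ∑ i ∈ Ico n (n + δ), ((2 * n).choose (i + 1) : ℝ) := by
    refine Finset.sum_nbij' (fun i => i - 1) (fun i => i + 1) ?_ ?_ ?_ ?_ ?_
    · intro i hi; simp only [mem_Ioc, mem_Ico] at hi ⊢; omega
    · intro i hi; simp only [mem_Ioc, mem_Ico] at hi ⊢; omega
    · intro i hi; simp only [mem_Ioc] at hi; omega
    · intro i hi; omega
    · intro i hi
      simp only [mem_Ioc] at hi
      rw [Nat.sub_add_cancel (by omega)]
  rw [h]
  refine sum_le_sum fun i hi => ?_
  rw [mem_Ico] at hi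
  exact_mod_cast choose_succ_le_of_le (m := 2 * n) (i := i) (by omega)

/-- **Lemma 7 (HRSS), first display**: for `δ = δ_4(n)` and `n ≥ 1500`,
`4^{-n} Σ_{i=−δ+1}^{δ} C(2n, n+i) > 0.6088`. [cite: HirvonenRybickiSchmidSuomela2017, Appendix A,
Lemma 7] -/
theorem hrss_lemma7_first {n : ℕ} (hn : 1500 ≤ n) :
    0.6088 * (4 : ℝ) ^ n < ∑ i ∈ Ioc (n - dlt 4 n) (n + dlt 4 n), ((2 * n).choose i : ℝ) := by
  have hδn := dlt_four_le n
  have hT := hrss_lemma7_half hn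
  rw [← sum_Ioc_consecutive _ (show n - dlt 4 n ≤ n by omega) (show n ≤ n + dlt 4 n by omega),
    sum_Ioc_reflect hδn]
  have h2 := sum_Ioc_le_sum_Ico n (dlt 4 n)
  have h4 : (0 : ℝ) < 4 ^ n := by positivity
  linarith

/-- **Lemma 7 (HRSS), second display**: for `δ = δ_4(n)` and `n ≥ 1500`,
`4^{-n} Σ_{i=−δ+1}^{δ−1} C(2n, n+i) > 0.5975` (the last term is at most the average of the
upper half: factor `2 − 1/δ ≥ 2 − 1/27`). [cite: HirvonenRybickiSchmidSuomela2017, Appendix A,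
Lemma 7] -/
theorem hrss_lemma7_second {n : ℕ} (hn : 1500 ≤ n) :
    0.5975 * (4 : ℝ) ^ n < ∑ i ∈ Ioc (n - dlt 4 n) (n + dlt 4 n - 1), ((2 * n).choose i : ℝ) := by
  set δ := dlt 4 n with hδ
  have hδn : δ ≤ n := dlt_four_le n
  have hδ27 : 27 ≤ δ := by
    have := dlt_mono_right 4 hn
    rw [dlt_1500.2.2.2] at this
    exact this
  have hT := hrss_lemma7_half hn
  rw [← hδ] at hT
  set T := ∑ i ∈ Ioc n (n + δ), ((2 * n).choose i : ℝ) with hTdef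
  -- the full sum splits off its last term
  have hS1 : ∑ i ∈ Ioc (n - δ) (n + δ), ((2 * n).choose i : ℝ) =
      ∑ i ∈ Ioc (n - δ) (n + δ - 1), ((2 * n).choose i : ℝ) + ((2 * n).choose (n + δ) : ℝ) := by
    rw [show n + δ = (n + δ - 1) + 1 by omega, sum_Ioc_succ_top (by omega)]
    rw [show n + δ - 1 + 1 = n + δ by omega]
  have hS1ge : 2 * T ≤ ∑ i ∈ Ioc (n - δ) (n + δ), ((2 * n).choose i : ℝ) := by
    rw [← sum_Ioc_consecutive _ (show n - δ ≤ n by omega) (show n ≤ n + δ by omega),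
      sum_Ioc_reflect hδn]
    have h2 := sum_Ioc_le_sum_Ico n δ
    rw [← hTdef] at h2 ⊢
    linarith
  -- the last term is at most `T/δ`
  have hlast : (δ : ℝ) * ((2 * n).choose (n + δ) : ℝ) ≤ T := by
    have := block_sum_ge n 0 δ (Nat.zero_le _)
    rw [Nat.sub_zero, add_zero] at this
    exact this
  have hδR : (27 : ℝ) ≤ δ := by exact_mod_cast hδ27
  have h4 : (0 : ℝ) < 4 ^ n := by positivity
  have hlast' : ((2 * n).choose (n + δ) : ℝ) ≤ T / 27 := by
    rw [le_div_iff₀ (by norm_num)]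
    have : (0 : ℝ) ≤ ((2 * n).choose (n + δ) : ℝ) := by positivity
    nlinarith
  linarith [hS1, hS1ge, hlast']


/-! ## The threshold `τ = ⌈(d+√d)/2⌉` against `δ' = δ_4(n)` -/

/-- Odd `d = 2n+1`: `δ = τ − n` satisfies `δ' + 1 ≤ δ ≤ δ' + 2` (“`√(n/2) < √(n/2+1/4) + 1/2 <
√(n/2) + 1`”). [cite: HirvonenRybickiSchmidSuomela2017, Appendix A, “Odd d”] -/
theorem threshold_odd (n : ℕ) :
    n + dlt 4 n + 1 ≤ hrssThreshold (2 * n + 1) ∧ hrssThreshold (2 * n + 1) ≤ n + dlt 4 n + 2 := by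
  set e := dlt 4 n with he
  have h1 : 2 * e ^ 2 ≤ n := two_mul_dlt_four_sq_le n
  have h2 : 16 * n < 32 * (e + 1) ^ 2 := by simpa using lt_dlt_succ_sq 4 n
  have h2' : n + 1 ≤ 2 * (e + 1) ^ 2 := by
    by_contra hc
    push Not at hc
    have := Nat.mul_le_mul_left 16 hc
    linarith
  have hsq_lo : (2 * e : ℝ) < Real.sqrt ((2 * n + 1 : ℕ) : ℝ) := by
    rw [Real.lt_sqrt (by positivity : (0 : ℝ) ≤ 2 * e)]
    have : ((2 * e ^ 2 : ℕ) : ℝ) ≤ n := by exact_mod_cast h1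
    push_cast at this ⊢
    nlinarith
  have hsq_hi : Real.sqrt ((2 * n + 1 : ℕ) : ℝ) < 2 * e + 2 := by
    rw [Real.sqrt_lt' (by positivity : (0 : ℝ) < 2 * e + 2)]
    have : ((n + 1 : ℕ) : ℝ) ≤ ((2 * (e + 1) ^ 2 : ℕ) : ℝ) := by exact_mod_cast h2'
    push_cast at this ⊢
    nlinarith
  have hlo := Nat.le_ceil ((((2 * n + 1 : ℕ) : ℝ) + Real.sqrt ((2 * n + 1 : ℕ) : ℝ)) / 2)
  have hhi := Nat.ceil_lt_add_one (show (0 : ℝ) ≤ (((2 * n + 1 : ℕ) : ℝ) +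
    Real.sqrt ((2 * n + 1 : ℕ) : ℝ)) / 2 by positivity)
  change _ ≤ (hrssThreshold (2 * n + 1) : ℝ) at hlo
  change (hrssThreshold (2 * n + 1) : ℝ) < _ at hhi
  set τ := hrssThreshold (2 * n + 1)
  push_cast at hlo hhi hsq_lo hsq_hi
  constructor
  · have : ((n + e : ℕ) : ℝ) < τ := by push_cast; linarith
    have : n + e < τ := by exact_mod_cast this
    omega
  · have : (τ : ℝ) < ((n + e + 3 : ℕ) : ℝ) := by push_cast; linarith
    have : τ < n + e + 3 := by exact_mod_cast this
    omega

/-- Even `d = 2n`: `δ = τ − n = ⌈√(n/2)⌉` satisfies `δ' ≤ δ ≤ δ' + 1`. [cite: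
HirvonenRybickiSchmidSuomela2017, Appendix A, “Even d”] -/
theorem threshold_even (n : ℕ) :
    n + dlt 4 n ≤ hrssThreshold (2 * n) ∧ hrssThreshold (2 * n) ≤ n + dlt 4 n + 1 := by
  set e := dlt 4 n with he
  have h1 : 2 * e ^ 2 ≤ n := two_mul_dlt_four_sq_le n
  have h2 : 16 * n < 32 * (e + 1) ^ 2 := by simpa using lt_dlt_succ_sq 4 n
  have h2' : n + 1 ≤ 2 * (e + 1) ^ 2 := by
    by_contra hc
    push Not at hc
    have := Nat.mul_le_mul_left 16 hc
    linarith
  have hsq_lo : (2 * e : ℝ) ≤ Real.sqrt ((2 * n : ℕ) : ℝ) := by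
    rw [show (2 * e : ℝ) = Real.sqrt ((2 * e) ^ 2) by rw [Real.sqrt_sq (by positivity)]]
    refine Real.sqrt_le_sqrt ?_
    have : ((2 * e ^ 2 : ℕ) : ℝ) ≤ n := by exact_mod_cast h1
    push_cast at this ⊢
    nlinarith
  have hsq_hi : Real.sqrt ((2 * n : ℕ) : ℝ) < 2 * e + 2 := by
    rw [Real.sqrt_lt' (by positivity : (0 : ℝ) < 2 * e + 2)]
    have : ((n + 1 : ℕ) : ℝ) ≤ ((2 * (e + 1) ^ 2 : ℕ) : ℝ) := by exact_mod_cast h2'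
    push_cast at this ⊢
    nlinarith
  have hlo := Nat.le_ceil ((((2 * n : ℕ) : ℝ) + Real.sqrt ((2 * n : ℕ) : ℝ)) / 2)
  have hhi := Nat.ceil_lt_add_one (show (0 : ℝ) ≤ (((2 * n : ℕ) : ℝ) +
    Real.sqrt ((2 * n : ℕ) : ℝ)) / 2 by positivity)
  change _ ≤ (hrssThreshold (2 * n) : ℝ) at hlo
  change (hrssThreshold (2 * n) : ℝ) < _ at hhi
  set τ := hrssThreshold (2 * n)
  push_cast at hlo hhi hsq_lo hsq_hi
  constructor
  · have : ((n + e : ℕ) : ℝ) ≤ τ := by push_cast; linarith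
    exact_mod_cast this
  · have : (τ : ℝ) < ((n + e + 2 : ℕ) : ℝ) := by push_cast; linarith
    have : τ < n + e + 2 := by exact_mod_cast this
    omega

/-! ## The two ratio constants and the final numerical comparison -/

/-- `(n − δ')/(n + δ' + 1) ≥ 0.963` for `n ≥ 1500` (the paper prints `0.964`, which needs the
integrality of `δ'`; `0.963` follows from `δ' ≤ √(n/2)` alone and suffices). [cite:
HirvonenRybickiSchmidSuomela2017, Appendix A, “Odd d” (the factor `(n−δ')/(n+δ'+1) > 0.964`)] -/
theorem ratio_odd {n : ℕ} (hn : 1500 ≤ n) :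
    0.963 ≤ ((n : ℝ) - dlt 4 n) / (n + dlt 4 n + 1) := by
  have h1 : ((2 * dlt 4 n ^ 2 : ℕ) : ℝ) ≤ n := by exact_mod_cast two_mul_dlt_four_sq_le n
  push_cast at h1
  have hnR : (1500 : ℝ) ≤ n := by exact_mod_cast hn
  set e : ℝ := (dlt 4 n : ℝ) with he
  have he0 : 0 ≤ e := by positivity
  set t : ℝ := (0.037 * n - 0.963) / 1.963 with ht
  have ht0 : 0 ≤ t := by rw [ht]; apply div_nonneg <;> linarith
  have het : e ≤ t := by
    refine le_of_pow_le_pow_left₀ two_ne_zero ht0 ?_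
    rw [ht, div_pow]
    rw [le_div_iff₀ (by norm_num)]
    nlinarith [sq_nonneg ((n : ℝ) - 1500)]
  rw [le_div_iff₀ (by positivity)]
  rw [ht, le_div_iff₀ (by norm_num)] at het
  linarith

/-- `(n − δ')/n ≥ 0.9815` for `n ≥ 1501` (the paper prints `0.982`, again via integrality;
`0.9815` follows from `δ' ≤ √(n/2)`). [cite: HirvonenRybickiSchmidSuomela2017, Appendix A,
“Even d” (the factor `(n−δ')/n > 0.982`)] -/
theorem ratio_even {n : ℕ} (hn : 1501 ≤ n) : 0.9815 ≤ ((n : ℝ) - dlt 4 n) / n := by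
  have h1 : ((2 * dlt 4 n ^ 2 : ℕ) : ℝ) ≤ n := by exact_mod_cast two_mul_dlt_four_sq_le n
  push_cast at h1
  have hnR : (1501 : ℝ) ≤ n := by exact_mod_cast hn
  set e : ℝ := (dlt 4 n : ℝ) with he
  have he0 : 0 ≤ e := by positivity
  have het : e ≤ 0.0185 * n := by
    refine le_of_pow_le_pow_left₀ two_ne_zero (by positivity) ?_
    nlinarith
  rw [le_div_iff₀ (by positivity)]
  linarith

/-- Numerics: `g_4 = e^{-1/2} ≥ 0.6065`. [cite: HirvonenRybickiSchmidSuomela2017, Appendix A] -/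
theorem g_four_ge : 0.6065 ≤ g 4 := by
  have e4 := sum_sub_le_exp_neg (show (0:ℝ) ≤ (4:ℕ)^2/32 by positivity) (by norm_num) 8 (by norm_num)
  simp only [sum_range_succ, sum_range_zero, Nat.factorial] at e4
  unfold g
  norm_num at e4 ⊢
  linarith

/-- The closing comparison for odd `d = 2n+1`: `9/(32√(2n+1)) ≤ K · √(2/(π(2n+1)))` as soon as
`K ≥ 0.3537` (i.e. `81π ≤ 2048 K²`). [cite: HirvonenRybickiSchmidSuomela2017, Appendix A, “Odd d”
(“`> ½ + 0.2823/√(d−1) > ½ + 9/(32√d)`”)] -/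
theorem final_odd (n : ℕ) {K : ℝ} (hK : 0.3537 ≤ K) :
    9 / (32 * Real.sqrt ((2 * n + 1 : ℕ) : ℝ)) ≤ K * Real.sqrt (2 / (π * (2 * n + 1))) := by
  have hx : (0 : ℝ) < (2 * n + 1 : ℕ) := by positivity
  have hK0 : 0 ≤ K := by linarith
  have hK2 : 0.3537 ^ 2 ≤ K ^ 2 := pow_le_pow_left₀ (by norm_num) hK 2
  have key : 81 * π ≤ 2048 * K ^ 2 := by nlinarith [Real.pi_lt_d6]
  refine le_of_pow_le_pow_left₀ two_ne_zero (by positivity) ?_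
  rw [div_pow, mul_pow, mul_pow, Real.sq_sqrt hx.le, Real.sq_sqrt (by positivity)]
  push_cast
  have hπ := Real.pi_pos
  calc (9 : ℝ) ^ 2 / (32 ^ 2 * (2 * n + 1)) = (81 * π) / (1024 * π * (2 * n + 1)) := by
        rw [div_eq_div_iff (by positivity) (by positivity)]; ring
    _ ≤ (2048 * K ^ 2) / (1024 * π * (2 * n + 1)) :=
        div_le_div_of_nonneg_right key (by positivity)
    _ = K ^ 2 * 2 / (π * (2 * n + 1)) := by
        rw [div_eq_div_iff (by positivity) (by positivity)]; ring
    _ = K ^ 2 * (2 / (π * (2 * n + 1))) := by rw [← mul_div_assoc']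

/-- The closing comparison for even `d = 2n`, `n ≥ 1501`: `9/(32√(2n)) ≤ K · √(2/(π(2n+1)))` for
`K ≥ 0.3537`. [cite: HirvonenRybickiSchmidSuomela2017, Appendix A, “Even d” (“`> ½ + 0.2822/√d >
½ + 9/(32√d)`”)] -/
theorem final_even {n : ℕ} (hn : 1501 ≤ n) {K : ℝ} (hK : 0.3537 ≤ K) :
    9 / (32 * Real.sqrt ((2 * n : ℕ) : ℝ)) ≤ K * Real.sqrt (2 / (π * (2 * n + 1))) := by
  have hnR : (1501 : ℝ) ≤ n := by exact_mod_cast hn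
  have hx : (0 : ℝ) < (2 * n : ℕ) := by push_cast; linarith
  have hK0 : 0 ≤ K := by linarith
  have hK2 : 0.3537 ^ 2 ≤ K ^ 2 := pow_le_pow_left₀ (by norm_num) hK 2
  have key : 81 * π * (2 * n + 1) ≤ 4096 * n * K ^ 2 := by
    nlinarith [Real.pi_lt_d6, Real.pi_pos,
      mul_le_mul_of_nonneg_left hK2 (show (0:ℝ) ≤ n by positivity)]
  refine le_of_pow_le_pow_left₀ two_ne_zero (by positivity) ?_
  rw [div_pow, mul_pow, mul_pow, Real.sq_sqrt hx.le, Real.sq_sqrt (by positivity)]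
  push_cast
  have hπ := Real.pi_pos
  have hn0 : (0 : ℝ) < n := by linarith
  calc (9 : ℝ) ^ 2 / (32 ^ 2 * (2 * n)) = (81 * π * (2 * n + 1)) / (2048 * n * π * (2 * n + 1)) := by
        rw [div_eq_div_iff (by positivity) (by positivity)]; ring
    _ ≤ (4096 * n * K ^ 2) / (2048 * n * π * (2 * n + 1)) :=
        div_le_div_of_nonneg_right key (by positivity)
    _ = K ^ 2 * 2 / (π * (2 * n + 1)) := by
        rw [div_eq_div_iff (by positivity) (by positivity)]; ring
    _ = K ^ 2 * (2 / (π * (2 * n + 1))) := by rw [← mul_div_assoc']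


/-! ## Odd `d = 2n + 1`, `n ≥ 1500` -/

/-- **Theorem 4 for odd `d = 2n+1 > 3000`** (“`α(τ,d) ≥ ½ + (n−δ')/(n+δ'+1) · 4^{-n} C(2n, n+δ')
· 4^{-n} Σ_{i=−δ'+1}^{δ'} C(2n, n+i) > ½ + 0.964 · 0.995 · g_4 · 0.999/√(πn) · 0.6088 > ½ +
9/(32√d)`”). [cite: HirvonenRybickiSchmidSuomela2017, §2.6 Theorem 4; Appendix A, “Odd d”] -/
theorem hrss_theorem4_odd {n : ℕ} (hn : 1500 ≤ n) :
    1 / 2 + 9 / (32 * Real.sqrt ((2 * n + 1 : ℕ) : ℝ)) ≤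
      alpha (hrssThreshold (2 * n + 1)) (2 * n + 1) := by
  obtain ⟨hτ1, hτ2⟩ := threshold_odd n
  set e := dlt 4 n with he
  set τ := hrssThreshold (2 * n + 1) with hτ
  have hen : e ≤ n := dlt_four_le n
  rw [alpha_eq_alphaNum, add_le_add_iff_left]
  -- ℕ-level lower bound on the numerator
  have hnum : (2 * n).choose (n + e + 1) * ∑ i ∈ Ioc (n - e) (n + e), (2 * n).choose i ≤
      alphaNum τ (2 * n + 1) := by
    unfold alphaNum
    rw [show 2 * n + 1 - 1 = 2 * n by omega]
    refine Nat.mul_le_mul (choose_anti (by omega) (by omega)) (sum_le_sum_of_subset fun i hi => ?_)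
    rw [mem_Ioc] at hi
    rw [mem_Icc]
    omega
  have hnumR : (((2 * n).choose (n + e + 1) : ℕ) : ℝ) *
      ∑ i ∈ Ioc (n - e) (n + e), ((2 * n).choose i : ℝ) ≤ (alphaNum τ (2 * n + 1) : ℝ) := by
    exact_mod_cast hnum
  -- the three factors
  have hS := (hrss_lemma7_first hn).le
  have hrec : (((2 * n).choose (n + e + 1) : ℕ) : ℝ) * ((n : ℝ) + e + 1) =
      ((2 * n).choose (n + e) : ℝ) * ((n : ℝ) - e) := by
    have := choose_succ_mul_cast (2 * n) (n + e)
    rw [show 2 * n - (n + e) = n - e by omega, Nat.cast_sub hen] at this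
    push_cast at this
    linarith
  have hratio := ratio_odd hn
  have hL6 := hrss_lemma6 (j := 4) (by simp) hn
  rw [← he] at hL6 hratio
  have hCeq : ((2 * n).choose n : ℝ) = cbin n * 4 ^ n := by unfold cbin; field_simp
  have hcb := sqrt_le_cbin n
  have hg4 := g_four_ge
  have h4 : (0 : ℝ) < 4 ^ n := by positivity
  -- `choose (n+e+1) ≥ 0.963 · 0.995 · g 4 · ℓ · 4^n`
  have hA : 0.963 * (0.995 * g 4 * (Real.sqrt (2 / (π * (2 * n + 1))) * 4 ^ n)) ≤
      (((2 * n).choose (n + e + 1) : ℕ) : ℝ) := by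
    have hpos : (0 : ℝ) < (n : ℝ) + e + 1 := by positivity
    have e1 : (((2 * n).choose (n + e + 1) : ℕ) : ℝ) =
        ((n : ℝ) - e) / (n + e + 1) * ((2 * n).choose (n + e) : ℝ) := by
      field_simp
      linarith [hrec]
    rw [e1]
    have hB : 0.995 * g 4 * (Real.sqrt (2 / (π * (2 * n + 1))) * 4 ^ n) ≤
        ((2 * n).choose (n + e) : ℝ) := by
      refine le_trans ?_ hL6
      rw [hCeq]
      have : 0 ≤ 0.995 * g 4 := by positivity
      nlinarith [mul_le_mul_of_nonneg_left (mul_le_mul_of_nonneg_right hcb h4.le) this]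
    have h0 : (0 : ℝ) ≤ 0.995 * g 4 * (Real.sqrt (2 / (π * (2 * n + 1))) * 4 ^ n) := by positivity
    calc 0.963 * (0.995 * g 4 * (Real.sqrt (2 / (π * (2 * n + 1))) * 4 ^ n))
        ≤ ((n : ℝ) - e) / (n + e + 1) * (0.995 * g 4 * (Real.sqrt (2 / (π * (2 * n + 1))) * 4 ^ n)) :=
          mul_le_mul_of_nonneg_right hratio h0
      _ ≤ _ := mul_le_mul_of_nonneg_left hB (by linarith)
  -- assemble
  have hK : 0.3537 ≤ 0.963 * 0.995 * 0.6088 * g 4 := by nlinarith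
  have hfin := final_odd n hK
  rw [show 2 * n + 1 - 1 = 2 * n by omega]
  rw [le_div_iff₀ (by positivity)]
  have h16 : (4 : ℝ) ^ (2 * n) = 4 ^ n * 4 ^ n := by rw [two_mul, pow_add]
  rw [h16]
  have hℓ0 : 0 ≤ Real.sqrt (2 / (π * (2 * n + 1))) := Real.sqrt_nonneg _
  calc 9 / (32 * Real.sqrt ((2 * n + 1 : ℕ) : ℝ)) * (4 ^ n * 4 ^ n)
      ≤ 0.963 * 0.995 * 0.6088 * g 4 * Real.sqrt (2 / (π * (2 * n + 1))) * (4 ^ n * 4 ^ n) :=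
        mul_le_mul_of_nonneg_right hfin (by positivity)
    _ = (0.963 * (0.995 * g 4 * (Real.sqrt (2 / (π * (2 * n + 1))) * 4 ^ n))) *
        (0.6088 * 4 ^ n) := by ring
    _ ≤ (((2 * n).choose (n + e + 1) : ℕ) : ℝ) *
        ∑ i ∈ Ioc (n - e) (n + e), ((2 * n).choose i : ℝ) :=
        mul_le_mul hA hS (by positivity) (by positivity)
    _ ≤ _ := hnumR

/-! ## Even `d = 2n`, `n ≥ 1501` -/

/-- The row-halving identity (“`Σ_{i=−k}^{k} C(2n, n+i) = Σ (C(2n−1, n+i−1) + C(2n−1, n+i)) =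
2 Σ_{i=−k}^{k} C(2n−1, n+i)`”): Pascal's rule and the symmetry of row `2n−1` about `n − ½`.
[cite: HirvonenRybickiSchmidSuomela2017, Appendix A, “Even d” (the identity “for any k < n”)] -/
theorem two_mul_sum_choose_odd_row {n k : ℕ} (hk : k < n) :
    2 * ∑ i ∈ Icc (n - k) (n + k), (2 * n - 1).choose i =
      ∑ i ∈ Icc (n - k) (n + k), (2 * n).choose i := by
  have hP : ∀ i ∈ Icc (n - k) (n + k),
      (2 * n).choose i = (2 * n - 1).choose (i - 1) + (2 * n - 1).choose i := by
    intro i hi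
    rw [mem_Icc] at hi
    obtain ⟨i', rfl⟩ : ∃ i', i = i' + 1 := ⟨i - 1, by omega⟩
    obtain ⟨m, hm⟩ : ∃ m, 2 * n = m + 1 := ⟨2 * n - 1, by omega⟩
    rw [hm, Nat.add_sub_cancel, Nat.add_sub_cancel, Nat.choose_succ_succ']
  rw [sum_congr rfl hP, sum_add_distrib, two_mul]
  congr 1
  refine Finset.sum_nbij' (fun i => 2 * n - i) (fun i => 2 * n - i) ?_ ?_ ?_ ?_ ?_
  · intro i hi; simp only [mem_Icc] at hi ⊢; omega
  · intro i hi; simp only [mem_Icc] at hi ⊢; omega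
  · intro i hi; simp only [mem_Icc] at hi; omega
  · intro i hi; simp only [mem_Icc] at hi; omega
  · intro i hi
    simp only [mem_Icc] at hi
    rw [show 2 * n - i - 1 = (2 * n - 1) - i by omega, Nat.choose_symm (by omega)]

/-- **Theorem 4 for even `d = 2n > 3000`** (“`α(τ,d) ≥ ½ + (n−δ')/n · 4^{-n} C(2n, n+δ') · 4^{-n}
Σ_{i=−δ'+1}^{δ'−1} C(2n, n+i) > ½ + 0.982 · 0.995 · g_4 · 0.999/√(πn) · 0.5975 > ½ + 9/(32√d)`”).
[cite: HirvonenRybickiSchmidSuomela2017, §2.6 Theorem 4; Appendix A, “Even d”] -/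
theorem hrss_theorem4_even {n : ℕ} (hn : 1501 ≤ n) :
    1 / 2 + 9 / (32 * Real.sqrt ((2 * n : ℕ) : ℝ)) ≤ alpha (hrssThreshold (2 * n)) (2 * n) := by
  have hn' : 1500 ≤ n := by omega
  obtain ⟨hτ1, hτ2⟩ := threshold_even n
  set e := dlt 4 n with he
  set τ := hrssThreshold (2 * n) with hτ
  have hen : e ≤ n := dlt_four_le n
  have he27 : 27 ≤ e := by
    have := dlt_mono_right 4 hn'
    rw [dlt_1500.2.2.2] at this
    exact this
  rw [alpha_eq_alphaNum, add_le_add_iff_left]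
  -- ℕ-level lower bound on the numerator, in row `2n − 1`
  have hnum : (2 * n - 1).choose (n + e) * ∑ i ∈ Icc (n - (e - 1)) (n + (e - 1)), (2 * n - 1).choose i
      ≤ alphaNum τ (2 * n) := by
    unfold alphaNum
    refine Nat.mul_le_mul (choose_anti (by omega) (by omega)) (sum_le_sum_of_subset fun i hi => ?_)
    rw [mem_Icc] at hi ⊢
    omega
  -- halve the row: `2 Σ C(2n−1, i) = Σ C(2n, i)` on the symmetric window
  have hhalf := two_mul_sum_choose_odd_row (n := n) (k := e - 1) (by omega)
  have hwin : Icc (n - (e - 1)) (n + (e - 1)) = Ioc (n - e) (n + e - 1) := by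
    rw [show n - (e - 1) = (n - e) + 1 by omega, show n + (e - 1) = n + e - 1 by omega,
      Finset.Icc_add_one_left_eq_Ioc]
  rw [hwin] at hnum hhalf
  -- row change for the single coefficient: `C(2n−1, n+e) · 2n = C(2n, n+e) · (n − e)`
  have hrow : (2 * n - 1).choose (n + e) * (2 * n) = (2 * n).choose (n + e) * (n - e) := by
    have := Nat.choose_mul_succ_eq (2 * n - 1) (n + e)
    rw [show 2 * n - 1 + 1 = 2 * n by omega] at this
    rw [this, show 2 * n - (n + e) = n - e by omega]
  -- pass to ℝ
  have hnumR : (((2 * n - 1).choose (n + e) : ℕ) : ℝ) *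
      ∑ i ∈ Ioc (n - e) (n + e - 1), ((2 * n - 1).choose i : ℝ) ≤ (alphaNum τ (2 * n) : ℝ) := by
    exact_mod_cast hnum
  have hhalfR : (2 : ℝ) * ∑ i ∈ Ioc (n - e) (n + e - 1), ((2 * n - 1).choose i : ℝ) =
      ∑ i ∈ Ioc (n - e) (n + e - 1), ((2 * n).choose i : ℝ) := by
    exact_mod_cast hhalf
  have hrowR : (((2 * n - 1).choose (n + e) : ℕ) : ℝ) * (2 * n) =
      ((2 * n).choose (n + e) : ℝ) * ((n : ℝ) - e) := by
    have : (((2 * n - 1).choose (n + e) * (2 * n) : ℕ) : ℝ) =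
        (((2 * n).choose (n + e) * (n - e) : ℕ) : ℝ) := by exact_mod_cast hrow
    push_cast [Nat.cast_sub hen] at this
    linarith
  -- the three factors
  have hS := (hrss_lemma7_second hn').le
  rw [← he] at hS
  have hratio := ratio_even hn
  have hL6 := hrss_lemma6 (j := 4) (by simp) hn'
  rw [← he] at hL6 hratio
  have hCeq : ((2 * n).choose n : ℝ) = cbin n * 4 ^ n := by unfold cbin; field_simp
  have hcb := sqrt_le_cbin n
  have hg4 := g_four_ge
  have h4 : (0 : ℝ) < 4 ^ n := by positivity
  have hnR : (0 : ℝ) < n := lt_of_lt_of_le (by norm_num) (show (1501 : ℝ) ≤ n by exact_mod_cast hn)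
  have hB : 0.995 * g 4 * (Real.sqrt (2 / (π * (2 * n + 1))) * 4 ^ n) ≤
      ((2 * n).choose (n + e) : ℝ) := by
    refine le_trans ?_ hL6
    rw [hCeq]
    have : 0 ≤ 0.995 * g 4 := by positivity
    nlinarith [mul_le_mul_of_nonneg_left (mul_le_mul_of_nonneg_right hcb h4.le) this]
  -- `C(2n−1, n+e) = ((n−e)/n) · C(2n, n+e) / 2 ≥ 0.9815 · (…) / 2`
  have hA : 0.9815 * (0.995 * g 4 * (Real.sqrt (2 / (π * (2 * n + 1))) * 4 ^ n)) / 2 ≤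
      (((2 * n - 1).choose (n + e) : ℕ) : ℝ) := by
    have e1 : (((2 * n - 1).choose (n + e) : ℕ) : ℝ) =
        ((n : ℝ) - e) / n * ((2 * n).choose (n + e) : ℝ) / 2 := by
      field_simp
      linarith [hrowR]
    rw [e1]
    have h0 : (0 : ℝ) ≤ 0.995 * g 4 * (Real.sqrt (2 / (π * (2 * n + 1))) * 4 ^ n) := by positivity
    have := mul_le_mul hratio hB h0 (by linarith)
    linarith
  -- assemble
  have hK : 0.3537 ≤ 0.9815 * 0.995 * 0.5975 * g 4 := by nlinarith
  have hfin := final_even hn hK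
  rw [le_div_iff₀ (by positivity)]
  have h16 : (4 : ℝ) ^ (2 * n - 1) = 4 ^ n * 4 ^ n / 4 := by
    rw [eq_div_iff (by norm_num), ← pow_succ, show 2 * n - 1 + 1 = 2 * n by omega, two_mul, pow_add]
  rw [h16]
  calc 9 / (32 * Real.sqrt ((2 * n : ℕ) : ℝ)) * (4 ^ n * 4 ^ n / 4)
      ≤ 0.9815 * 0.995 * 0.5975 * g 4 * Real.sqrt (2 / (π * (2 * n + 1))) * (4 ^ n * 4 ^ n / 4) :=
        mul_le_mul_of_nonneg_right hfin (by positivity)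
    _ = (0.9815 * (0.995 * g 4 * (Real.sqrt (2 / (π * (2 * n + 1))) * 4 ^ n)) / 2) *
        ((0.5975 * 4 ^ n) / 2) := by ring
    _ ≤ (((2 * n - 1).choose (n + e) : ℕ) : ℝ) *
        ((∑ i ∈ Ioc (n - e) (n + e - 1), ((2 * n).choose i : ℝ)) / 2) :=
        mul_le_mul hA (by linarith) (by positivity) (by positivity)
    _ = (((2 * n - 1).choose (n + e) : ℕ) : ℝ) *
        ∑ i ∈ Ioc (n - e) (n + e - 1), ((2 * n - 1).choose i : ℝ) := by
        rw [← hhalfR]; ring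
    _ ≤ _ := hnumR

/-! ## Theorem 4 for every `d ≥ 2`, and the cut corollary -/

/-- **Theorem 4 (HRSS) for `d > 3000`** — the analytic half of the printed proof (“Prove a
closed-form lower bound for `d > 3000`”). [cite: HirvonenRybickiSchmidSuomela2017, §2.6 Theorem 4;
Appendix A] -/
theorem hrss_theorem4_large {d : ℕ} (hd : 3000 < d) :
    1 / 2 + 9 / (32 * Real.sqrt d) ≤ alpha (hrssThreshold d) d := by
  obtain ⟨n, rfl | rfl⟩ := Nat.even_or_odd' d
  · exact hrss_theorem4_even (n := n) (by omega)
  · exact hrss_theorem4_odd (n := n) (by omega)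

/-- **Theorem 4 (HRSS), all degrees.** For every `d ≥ 2` and `τ = ⌈(d + √d)/2⌉`,
`α(τ, d) ≥ ½ + 9/(32√d) = ½ + 0.28125/√d`: the computer range `2 ≤ d ≤ 3000` is the kernel
replay `hrss_theorem4_le_3000` of `TriangleFreeLocalCutTheorem4`, the range `d > 3000` is
`hrss_theorem4_large` above. [cite: HirvonenRybickiSchmidSuomela2017, §1.4 eq. (5), §2.6
Theorem 4, Appendix A] -/
theorem hrss_theorem4 {d : ℕ} (hd : 2 ≤ d) :
    1 / 2 + 9 / (32 * Real.sqrt d) ≤ alpha (hrssThreshold d) d := by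
  by_cases h : d ≤ 3000
  · exact hrss_theorem4_le_3000 d (Finset.mem_Icc.2 ⟨hd, h⟩)
  · exact hrss_theorem4_large (by omega)

/-- **Corollary (HRSS §1.1): in every `d`-regular triangle-free graph, `d ≥ 2`, there is a cut
containing at least `(½ + 0.28125/√d) · |E|` edges** — the one-round threshold algorithm
achieves this in expectation (`exists_cutCount_ge_alpha`), hence some outcome does. [cite:
HirvonenRybickiSchmidSuomela2017, §1.1 (“this shows that in any d-regular triangle-free graph
there exists a cut of at least this size”) and §2.6 Theorem 4] -/
theorem exists_cut_ge_hrss_all {V : Type*} [Fintype V] [DecidableEq V] (G : _root_.SimpleGraph V)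
    [DecidableRel G.Adj] {d : ℕ} (hd : 2 ≤ d) (hreg : G.IsRegularOfDegree d)
    (hG : G.CliqueFree 3) :
    ∃ c : V → Bool, (#G.edgeFinset : ℝ) * (1 / 2 + 9 / (32 * Real.sqrt d)) ≤ cutCount G c := by
  have hd1 : 1 ≤ d := by omega
  have hdτ : d < 2 * hrssThreshold d := by
    have h1 : ((d : ℝ) + Real.sqrt d) / 2 ≤ (hrssThreshold d : ℝ) := by
      unfold hrssThreshold
      exact Nat.le_ceil _
    have h2 : (0 : ℝ) < Real.sqrt d := Real.sqrt_pos.2 (by exact_mod_cast hd1)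
    have h3 : (d : ℝ) < 2 * (hrssThreshold d : ℝ) := by linarith
    exact_mod_cast h3
  obtain ⟨c, hc⟩ := exists_cutCount_ge_alpha G hd1 hreg hG hdτ
  exact ⟨c, (mul_le_mul_of_nonneg_left (hrss_theorem4 hd) (Nat.cast_nonneg _)).trans hc⟩

end Literature.Combinatorics.SimpleGraph.TriangleFreeLocalCutLargeDegree
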